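import Mathlib.NumberTheory.ArithmeticFunction.Misc
import Mathlib.Analysis.SpecialFunctions.Log.Basic
import Literature.NumberTheory.Sieve.SieveFramework
import HarnessLib

/-!
# Richert's logarithmic weights: the combinatorial layer of the weighted sieve

Topic `Literature/NumberTheory/Sieve`. This file PROVES the elementary (sieve-free) part of the
weighted sieve procedure behind Diamond–Halberstam, *Some applications of sieves of dimension
exceeding 1* (1997), Theorem 1 [DiamondHalberstam1997] (= Halberstam–Richert, *Sieve Methods*,
Thm 10.1, with Richert's 1969 logarithmic weights): for a finite family of positive integers `v(n)`,
`n ∈ I`, sifted by the primes `< z`, one attaches to the surviving `n` the weight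

  `w(n) = 1 − λ⁻¹ ∑_{z ≤ p < y, p ∣ v(n)} (1 − log p / log y)`

and uses two facts.

* (Richert's lemma, `cardFactors_sub_log_div_le`, `cardFactors_le_of_sum_lt`.) If `v = v(n)` has no
  prime factor `< z`, is not divisible by `p²` for any prime `z ≤ p < y`, and `w(n) > 0`, then
  `Ω(v) < λ + log v / log y`; so `Ω(v) ≤ r` as soon as `λ + log V / log y ≤ r + 1`, `v ≤ V`.
  (Proof: `Ω(v) − log v/log y = ∑_{p^k ∥ v} k (1 − log p/log y)`; the primes `p ≥ y` contribute
  `≤ 0`, the primes `p < y` occur to the first power.)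
* (The weighted-sum identity, `weightedSum_eq`.) `W := ∑_{n sifted} w(n) = S − λ⁻¹ ∑_{z ≤ p < y}
  (1 − log p/log y) S_p`, where `S = #{n ∈ I : (v(n), P(z)) = 1}` and
  `S_p = #{n ∈ I : (v(n), P(z)) = 1, p ∣ v(n)}`; and since `w(n) ≤ 1`,
  `W ≤ #{n sifted : w(n) > 0} ≤ #{n ∈ I : Ω(v(n)) ≤ r} + ∑_{z ≤ p < y} #{n ∈ I : p² ∣ v(n)}`
  (`weightedSum_le_card_add_sum`).

The consequence used by the sieve (`card_almostPrimes_ge`):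

  `#{n ∈ I : Ω(v(n)) ≤ r} ≥ S − λ⁻¹ ∑_{z ≤ p < y} (1 − log p/log y) S_p − ∑_{z ≤ p < y} #{n : p² ∣ v(n)}`.

The analytic evaluation of `S` (lower-bound sieve) and of the `S_p` (upper-bound sieve) is not done
here. Notation: `P(z) = primesProdBelow z` (`SieveFramework.lean`); the primes `z ≤ p < y` are
`primesIn z y = (Nat.primesBelow ⌈y⌉₊).filter (z ≤ ·)`, the indexing of `HasIwaniecDimension`.

## References

* H. Diamond, H. Halberstam, in *Sieve Methods, Exponential Sums, and their Applications in Number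
  Theory*, LMS LN 237 (1997), 101–107: Theorem 1 and display (1). [DiamondHalberstam1997]
* H. Halberstam, H.-E. Richert, *Sieve Methods* (1974), Ch. 9–10 (Thm 10.1). [HalberstamRichert1974]
-/

open Finset
open scoped ArithmeticFunction.Omega

noncomputable section

namespace Literature.NumberTheory.Sieve

namespace RichertWeights

/-! ### The logarithmic prime weight -/

/-- The logarithmic weight of a prime `p` relative to `y`: `1 − log p / log y`. [folklore] -/
def logWeight (y : ℝ) (p : ℕ) : ℝ := 1 - Real.log p / Real.log y

/-- Unfolding lemma. [folklore] -/
theorem logWeight_apply (y : ℝ) (p : ℕ) : logWeight y p = 1 - Real.log p / Real.log y := rfl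

/-- For `0 < p < y`, `1 < y`, the weight is positive. [folklore] -/
theorem logWeight_pos {y : ℝ} (hy : 1 < y) {p : ℕ} (hp : 0 < p) (hpy : (p : ℝ) < y) :
    0 < logWeight y p := by
  have hlogy : 0 < Real.log y := Real.log_pos hy
  have hp0 : (0 : ℝ) < p := by exact_mod_cast hp
  have : Real.log p < Real.log y := Real.log_lt_log hp0 hpy
  rw [logWeight_apply, sub_pos, div_lt_one hlogy]
  exact this

/-- For `y ≤ p`, `1 < y`, the weight is nonpositive. [folklore] -/
theorem logWeight_nonpos {y : ℝ} (hy : 1 < y) {p : ℕ} (hpy : y ≤ (p : ℝ)) : logWeight y p ≤ 0 := by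
  have hlogy : 0 < Real.log y := Real.log_pos hy
  have : Real.log y ≤ Real.log p := Real.log_le_log (by linarith) hpy
  rw [logWeight_apply, sub_nonpos, le_div_iff₀ hlogy, one_mul]
  exact this

/-- The weight is at most `1` for `p ≥ 1` and `y > 1`. [folklore] -/
theorem logWeight_le_one {y : ℝ} (hy : 1 < y) (p : ℕ) : logWeight y p ≤ 1 := by
  have hlogy : 0 < Real.log y := Real.log_pos hy
  have : 0 ≤ Real.log p := Real.log_natCast_nonneg p
  rw [logWeight_apply, sub_le_self_iff]
  positivity

/-! ### Richert's lemma: positive weight forces few prime factors -/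

/-- `Ω(m) − log m / log y = ∑_{p ∣ m} k_p (1 − log p / log y)` (`p^{k_p} ∥ m`; both sides vanish
at `m = 0`). [folklore] -/
theorem cardFactors_sub_log_div_eq (m : ℕ) (y : ℝ) :
    (Ω m : ℝ) - Real.log m / Real.log y =
      ∑ p ∈ m.primeFactors, (m.factorization p : ℝ) * logWeight y p := by
  have hΩ : (Ω m : ℝ) = ∑ p ∈ m.primeFactors, (m.factorization p : ℝ) := by
    rw [ArithmeticFunction.cardFactors_eq_sum_factorization, Finsupp.sum,
      Nat.support_factorization]
    push_cast
    rfl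
  have hlog : Real.log m = ∑ p ∈ m.primeFactors, (m.factorization p : ℝ) * Real.log p := by
    rw [Real.log_nat_eq_sum_factorization, Finsupp.sum, Nat.support_factorization]
  rw [hΩ, hlog, Finset.sum_div, ← Finset.sum_sub_distrib]
  refine Finset.sum_congr rfl fun p _ => ?_
  rw [logWeight_apply, mul_sub, mul_one, mul_div_assoc]

/-- **Richert's lemma** (the mechanism of the logarithmic weights): if `m ≠ 0`, `y > 1`, and no
prime `p < y` divides `m` to the second power, then
`Ω(m) − log m / log y ≤ ∑_{p ∣ m, p < y} (1 − log p / log y)` — the primes `≥ y` have nonpositive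
weight and the primes `< y` occur simply. [cite: DiamondHalberstam1997, Thm 1 (proof, via HR Thm 10.1)] -/
theorem cardFactors_sub_log_div_le {m : ℕ} (hm : m ≠ 0) {y : ℝ} (hy : 1 < y)
    (hsq : ∀ p ∈ m.primeFactors, (p : ℝ) < y → ¬ p ^ 2 ∣ m) :
    (Ω m : ℝ) - Real.log m / Real.log y ≤
      ∑ p ∈ m.primeFactors.filter (fun p : ℕ => (p : ℝ) < y), logWeight y p := by
  rw [cardFactors_sub_log_div_eq m y,
    ← Finset.sum_filter_add_sum_filter_not m.primeFactors (fun p : ℕ => (p : ℝ) < y)]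
  have h1 : ∑ p ∈ m.primeFactors.filter (fun p : ℕ => (p : ℝ) < y),
      (m.factorization p : ℝ) * logWeight y p =
      ∑ p ∈ m.primeFactors.filter (fun p : ℕ => (p : ℝ) < y), logWeight y p := by
    refine Finset.sum_congr rfl fun p hp => ?_
    rw [Finset.mem_filter] at hp
    have hpp : p.Prime := Nat.prime_of_mem_primeFactors hp.1
    have hpm : p ∣ m := Nat.dvd_of_mem_primeFactors hp.1
    have hk1 : 1 ≤ m.factorization p := by
      rwa [← hpp.dvd_iff_one_le_factorization hm]
    have hk2 : m.factorization p < 2 := by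
      by_contra h
      push Not at h
      exact hsq p hp.1 hp.2 ((hpp.pow_dvd_iff_le_factorization hm).mpr h)
    have : m.factorization p = 1 := by omega
    rw [this, Nat.cast_one, one_mul]
  have h2 : ∑ p ∈ m.primeFactors.filter (fun p : ℕ => ¬ (p : ℝ) < y),
      (m.factorization p : ℝ) * logWeight y p ≤ 0 := by
    refine Finset.sum_nonpos fun p hp => ?_
    rw [Finset.mem_filter, not_lt] at hp
    exact mul_nonpos_of_nonneg_of_nonpos (Nat.cast_nonneg _) (logWeight_nonpos hy hp.2)
  linarith

/-- **Richert's lemma, counting form**: under the hypotheses of `cardFactors_sub_log_div_le`, if the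
weighted prime sum is `< λ`, `m ≤ V` and `λ + log V / log y ≤ r + 1`, then `Ω(m) ≤ r`.
[cite: DiamondHalberstam1997, Thm 1 (1)] -/
theorem cardFactors_le_of_sum_lt {m : ℕ} (hm : m ≠ 0) {y lam V : ℝ} (hy : 1 < y) {r : ℕ}
    (hsq : ∀ p ∈ m.primeFactors, (p : ℝ) < y → ¬ p ^ 2 ∣ m)
    (hsum : ∑ p ∈ m.primeFactors.filter (fun p : ℕ => (p : ℝ) < y), logWeight y p < lam)
    (hmV : (m : ℝ) ≤ V) (hr : lam + Real.log V / Real.log y ≤ r + 1) : Ω m ≤ r := by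
  have hlogy : 0 < Real.log y := Real.log_pos hy
  have hm0 : (0 : ℝ) < m := by exact_mod_cast Nat.pos_of_ne_zero hm
  have hlogm : Real.log m / Real.log y ≤ Real.log V / Real.log y :=
    div_le_div_of_nonneg_right (Real.log_le_log hm0 hmV) hlogy.le
  have h := cardFactors_sub_log_div_le hm hy hsq
  have hlt : (Ω m : ℝ) < r + 1 := by linarith
  have : (Ω m : ℝ) < ((r + 1 : ℕ) : ℝ) := by push_cast; exact hlt
  have := Nat.cast_lt.mp this
  omega

/-! ### The primes `z ≤ p < y` and the weights -/

/-- `primesIn z y = {p prime : z ≤ p < y}`, written as `(Nat.primesBelow ⌈y⌉₊).filter (z ≤ ·)` —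
literally the index set of the window products in `HasIwaniecDimension` (`SieveFunctions.lean`), so
that the dimension condition applies to sums over it without rewriting. (The same set as
`Iwaniec1978.primesIn` of `IwaniecAlmostPrimes.lean`, which is phrased through `Finset.range` and is
not imported here to keep this combinatorial file light.) [folklore] -/
def primesIn (z y : ℝ) : Finset ℕ := (Nat.primesBelow ⌈y⌉₊).filter (fun p : ℕ => z ≤ (p : ℝ))

/-- Membership in `primesIn`. [folklore] -/
theorem mem_primesIn {z y : ℝ} {p : ℕ} : p ∈ primesIn z y ↔ p.Prime ∧ z ≤ (p : ℝ) ∧ (p : ℝ) < y := by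
  rw [primesIn, Finset.mem_filter, Nat.mem_primesBelow, Nat.lt_ceil]
  tauto

/-- Richert's weight of an integer `m` (parameters `z ≤ y`, `λ`):
`w(m) = 1 − λ⁻¹ ∑_{z ≤ p < y, p ∣ m} (1 − log p / log y)`. [cite: DiamondHalberstam1997, Thm 1 (proof)] -/
def weight (z y lam : ℝ) (m : ℕ) : ℝ :=
  1 - lam⁻¹ * ∑ p ∈ (primesIn z y).filter (· ∣ m), logWeight y p

/-- The prime sum inside the weight is nonnegative (`1 < y`). [folklore] -/
theorem sum_logWeight_nonneg {y : ℝ} (hy : 1 < y) (z : ℝ) (m : ℕ) :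
    0 ≤ ∑ p ∈ (primesIn z y).filter (· ∣ m), logWeight y p := by
  refine Finset.sum_nonneg fun p hp => ?_
  rw [Finset.mem_filter, mem_primesIn] at hp
  exact (logWeight_pos hy hp.1.1.pos hp.1.2.2).le

/-- `w(m) ≤ 1` for `λ > 0`, `y > 1`. [folklore] -/
theorem weight_le_one {z y lam : ℝ} (hy : 1 < y) (hlam : 0 < lam) (m : ℕ) : weight z y lam m ≤ 1 := by
  rw [weight, sub_le_self_iff]
  exact mul_nonneg (inv_nonneg.mpr hlam.le) (sum_logWeight_nonneg hy z m)

/-- If `w(m) > 0` (`λ > 0`) then the prime sum is `< λ`. [folklore] -/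
theorem sum_lt_of_weight_pos {z y lam : ℝ} (hlam : 0 < lam) {m : ℕ} (hw : 0 < weight z y lam m) :
    ∑ p ∈ (primesIn z y).filter (· ∣ m), logWeight y p < lam := by
  rw [weight, sub_pos, inv_mul_lt_iff₀ hlam, mul_one] at hw
  exact hw

/-- For `m ≠ 0` coprime to `P(z)`, the prime divisors of `m` below `y` are exactly the primes of
`primesIn z y` dividing `m`. [folklore] -/
theorem primeFactors_filter_eq {z y : ℝ} {m : ℕ} (hm : m ≠ 0) (hcop : m.Coprime (primesProdBelow z)) :
    m.primeFactors.filter (fun p : ℕ => (p : ℝ) < y) = (primesIn z y).filter (· ∣ m) := by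
  ext p
  rw [Finset.mem_filter, Finset.mem_filter, mem_primesIn, Nat.mem_primeFactors_of_ne_zero hm]
  constructor
  · rintro ⟨⟨hp, hpm⟩, hpy⟩
    refine ⟨⟨hp, ?_, hpy⟩, hpm⟩
    by_contra hlt
    push Not at hlt
    have hpP : p ∣ primesProdBelow z := (dvd_primesProdBelow_iff hp z).mpr hlt
    have : p ∣ Nat.gcd m (primesProdBelow z) := Nat.dvd_gcd hpm hpP
    rw [hcop] at this
    exact hp.one_lt.ne' (Nat.dvd_one.mp this)
  · rintro ⟨⟨hp, -, hpy⟩, hpm⟩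
    exact ⟨⟨hp, hpm⟩, hpy⟩

/-- **Positive weight detects almost-primes** (Richert): if `m ≠ 0` is coprime to `P(z)`, no prime
`z ≤ p < y` divides `m` twice, `w(m) > 0` with `λ > 0`, `m ≤ V` and `λ + log V / log y ≤ r + 1`,
then `Ω(m) ≤ r`. [cite: DiamondHalberstam1997, Thm 1 (1)] -/
theorem cardFactors_le_of_weight_pos {z y lam V : ℝ} {m : ℕ} {r : ℕ} (hm : m ≠ 0) (hy : 1 < y)
    (hlam : 0 < lam) (hcop : m.Coprime (primesProdBelow z))
    (hsq : ∀ p ∈ primesIn z y, ¬ p ^ 2 ∣ m) (hw : 0 < weight z y lam m) (hmV : (m : ℝ) ≤ V)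
    (hr : lam + Real.log V / Real.log y ≤ r + 1) : Ω m ≤ r := by
  have hset := primeFactors_filter_eq (y := y) hm hcop
  refine cardFactors_le_of_sum_lt hm hy (fun p hp hpy => ?_) ?_ hmV hr
  · have : p ∈ m.primeFactors.filter (fun p : ℕ => (p : ℝ) < y) := Finset.mem_filter.mpr ⟨hp, hpy⟩
    rw [hset, Finset.mem_filter] at this
    exact hsq p this.1
  · rw [hset]
    exact sum_lt_of_weight_pos hlam hw

/-! ### The weighted sum over a sifted family -/

variable (I : Finset ℕ) (v : ℕ → ℕ) (z y lam : ℝ)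

/-- The sifted part of the index set: `{n ∈ I : (v(n), P(z)) = 1}`. [folklore] -/
def sifted : Finset ℕ := I.filter fun n : ℕ => (v n).Coprime (primesProdBelow z)

/-- The weighted sum `W = ∑_{n ∈ I, (v(n), P(z)) = 1} w(v(n))`. [cite: DiamondHalberstam1997, Thm 1 (proof)] -/
def weightedSum : ℝ := ∑ n ∈ sifted I v z, weight z y lam (v n)

/-- **The weighted-sum identity**:
`W = S − λ⁻¹ ∑_{z ≤ p < y} (1 − log p/log y) · #{n sifted : p ∣ v(n)}`. [cite: DiamondHalberstam1997, Thm 1 (proof)] -/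
theorem weightedSum_eq :
    weightedSum I v z y lam = #(sifted I v z) -
      lam⁻¹ * ∑ p ∈ primesIn z y, logWeight y p * #((sifted I v z).filter fun n : ℕ => p ∣ v n) := by
  unfold weightedSum weight
  rw [Finset.sum_sub_distrib, Finset.sum_const, nsmul_eq_mul, mul_one, ← Finset.mul_sum]
  congr 2
  rw [Finset.sum_comm' (t' := primesIn z y) (s' := fun p => (sifted I v z).filter fun n : ℕ => p ∣ v n)]
  · refine Finset.sum_congr rfl fun p _ => ?_
    rw [Finset.sum_const, nsmul_eq_mul, mul_comm]
  · intro n p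
    simp only [Finset.mem_filter]
    tauto

/-- `W ≤ #{n sifted : w(v(n)) > 0}` (each weight is `≤ 1`; `λ > 0`, `y > 1`). [folklore] -/
theorem weightedSum_le_card_pos (hy : 1 < y) (hlam : 0 < lam) :
    weightedSum I v z y lam ≤ #((sifted I v z).filter fun n : ℕ => 0 < weight z y lam (v n)) := by
  unfold weightedSum
  rw [← Finset.sum_filter_add_sum_filter_not (sifted I v z) (fun n : ℕ => 0 < weight z y lam (v n))]
  have h1 : ∑ n ∈ (sifted I v z).filter (fun n : ℕ => 0 < weight z y lam (v n)), weight z y lam (v n) ≤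
      #((sifted I v z).filter fun n : ℕ => 0 < weight z y lam (v n)) := by
    rw [Finset.card_eq_sum_ones, Nat.cast_sum, Nat.cast_one]
    exact Finset.sum_le_sum fun n _ => weight_le_one hy hlam (v n)
  have h2 : ∑ n ∈ (sifted I v z).filter (fun n : ℕ => ¬ 0 < weight z y lam (v n)),
      weight z y lam (v n) ≤ 0 :=
    Finset.sum_nonpos fun n hn => not_lt.mp (Finset.mem_filter.mp hn).2
  linarith

/-- **Classification of the positively weighted survivors**: if every `v(n)`, `n ∈ I`, is non-zero and
`≤ V`, and `λ + log V/log y ≤ r + 1` (`λ > 0`, `y > 1`), then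
`#{n sifted : w > 0} ≤ #{n ∈ I : Ω(v(n)) ≤ r} + ∑_{z ≤ p < y} #{n ∈ I : p² ∣ v(n)}`.
[cite: DiamondHalberstam1997, Thm 1 (proof)] -/
theorem card_pos_le {V : ℝ} {r : ℕ} (hy : 1 < y) (hlam : 0 < lam)
    (hv : ∀ n ∈ I, v n ≠ 0 ∧ (v n : ℝ) ≤ V) (hr : lam + Real.log V / Real.log y ≤ r + 1) :
    (#((sifted I v z).filter fun n : ℕ => 0 < weight z y lam (v n)) : ℝ) ≤
      #(I.filter fun n : ℕ => Ω (v n) ≤ r) +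
        ∑ p ∈ primesIn z y, (#(I.filter fun n : ℕ => p ^ 2 ∣ v n) : ℝ) := by
  set T := (sifted I v z).filter fun n : ℕ => 0 < weight z y lam (v n) with hT
  -- split `T` according to the existence of a square prime factor in `[z, y)`
  have hsplit : (#T : ℝ) = #(T.filter fun n : ℕ => ¬ ∃ p ∈ primesIn z y, p ^ 2 ∣ v n) +
      #(T.filter fun n : ℕ => ∃ p ∈ primesIn z y, p ^ 2 ∣ v n) := by
    rw [← Nat.cast_add, add_comm, Finset.card_filter_add_card_filter_not]
  rw [hsplit]
  have hA : #(T.filter fun n : ℕ => ¬ ∃ p ∈ primesIn z y, p ^ 2 ∣ v n) ≤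
      #(I.filter fun n : ℕ => Ω (v n) ≤ r) := by
    -- Richert's lemma on the square-free-in-`[z,y)` part
    refine Finset.card_le_card fun n hn => ?_
    rw [Finset.mem_filter] at hn
    obtain ⟨hnT, hnsq⟩ := hn
    rw [hT, Finset.mem_filter, sifted, Finset.mem_filter] at hnT
    obtain ⟨⟨hnI, hcop⟩, hw⟩ := hnT
    push Not at hnsq
    rw [Finset.mem_filter]
    exact ⟨hnI, cardFactors_le_of_weight_pos (hv n hnI).1 hy hlam hcop hnsq hw (hv n hnI).2 hr⟩
  have hB : (#(T.filter fun n : ℕ => ∃ p ∈ primesIn z y, p ^ 2 ∣ v n) : ℝ) ≤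
      ∑ p ∈ primesIn z y, (#(I.filter fun n : ℕ => p ^ 2 ∣ v n) : ℝ) := by
    -- the part with a square prime factor
    calc (#(T.filter fun n : ℕ => ∃ p ∈ primesIn z y, p ^ 2 ∣ v n) : ℝ)
        ≤ #(I.filter fun n : ℕ => ∃ p ∈ primesIn z y, p ^ 2 ∣ v n) := by
          refine Nat.cast_le.mpr (Finset.card_le_card fun n hn => ?_)
          rw [Finset.mem_filter] at hn ⊢
          have : n ∈ I := by
            have := hn.1
            rw [hT, Finset.mem_filter, sifted, Finset.mem_filter] at this
            exact this.1.1
          exact ⟨this, hn.2⟩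
      _ ≤ ∑ p ∈ primesIn z y, (#(I.filter fun n : ℕ => p ^ 2 ∣ v n) : ℝ) := by
          have hsub : (I.filter fun n : ℕ => ∃ p ∈ primesIn z y, p ^ 2 ∣ v n) ⊆
              (primesIn z y).biUnion fun p => I.filter fun n : ℕ => p ^ 2 ∣ v n := by
            intro n hn
            rw [Finset.mem_filter] at hn
            obtain ⟨hnI, p, hp, hpn⟩ := hn
            exact Finset.mem_biUnion.mpr ⟨p, hp, Finset.mem_filter.mpr ⟨hnI, hpn⟩⟩
          calc (#(I.filter fun n : ℕ => ∃ p ∈ primesIn z y, p ^ 2 ∣ v n) : ℝ)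
              ≤ #((primesIn z y).biUnion fun p => I.filter fun n : ℕ => p ^ 2 ∣ v n) := by
                exact_mod_cast Finset.card_le_card hsub
            _ ≤ ∑ p ∈ primesIn z y, (#(I.filter fun n : ℕ => p ^ 2 ∣ v n) : ℝ) := by
                exact_mod_cast Finset.card_biUnion_le
  have hA' : (#(T.filter fun n : ℕ => ¬ ∃ p ∈ primesIn z y, p ^ 2 ∣ v n) : ℝ) ≤
      #(I.filter fun n : ℕ => Ω (v n) ≤ r) := by exact_mod_cast hA
  linarith

/-- **The weighted sieve, combinatorial conclusion** (Diamond–Halberstam Thm 1 / Halberstam–Richert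
Thm 10.1, before any sieve estimate is inserted): with `S = #{n ∈ I : (v(n), P(z)) = 1}`,
`S_p = #{n ∈ I : (v(n), P(z)) = 1, p ∣ v(n)}`, and under `v(n) ≠ 0`, `v(n) ≤ V` on `I`, `λ > 0`,
`y > 1`, `λ + log V / log y ≤ r + 1`:
`S − λ⁻¹ ∑_{z ≤ p < y} (1 − log p/log y) S_p ≤ #{n ∈ I : Ω(v(n)) ≤ r} + ∑_{z ≤ p < y} #{n ∈ I : p² ∣ v(n)}`.
[cite: DiamondHalberstam1997, Thm 1] -/
theorem card_almostPrimes_ge {V : ℝ} {r : ℕ} (hy : 1 < y) (hlam : 0 < lam)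
    (hv : ∀ n ∈ I, v n ≠ 0 ∧ (v n : ℝ) ≤ V) (hr : lam + Real.log V / Real.log y ≤ r + 1) :
    (#(sifted I v z) : ℝ) -
        lam⁻¹ * ∑ p ∈ primesIn z y, logWeight y p * #((sifted I v z).filter fun n : ℕ => p ∣ v n) ≤
      #(I.filter fun n : ℕ => Ω (v n) ≤ r) +
        ∑ p ∈ primesIn z y, (#(I.filter fun n : ℕ => p ^ 2 ∣ v n) : ℝ) := by
  rw [← weightedSum_eq]
  exact (weightedSum_le_card_pos I v z y lam hy hlam).trans (card_pos_le I v z y lam hy hlam hv hr)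

end RichertWeights

end Literature.NumberTheory.Sieve

end
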